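import Mathlib
import Literature.Computability.AlgebraicComplexity.ArithCircuitProofs
import Literature.Computability.AlgebraicComplexity.ConstantFreeCircuits

/-!
# Crux `DivisionGap.PerDivisionHard` (stmt-ValiantsHypothesis-5065), line `pair-descent-jss-endpoint` —
stub `stub_jssContraction`, part B: circuit toolkit for the Jukna–Seiwert–Sergeev contraction

Gate-list bookkeeping in the tree's model `ArithCircuit k σ` (a list of weighted-sum / product
gates with absolute gate references, total left-fold semantics `gateValues`, junk value `0`),
used by part C to splice fixed-shape sub-circuits into a monotone circuit:

* `padBlock L Q` : the gates of a circuit `Q` of size `≤ L`, padded with empty sum gates to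
  exactly `L` gates and followed by one copy gate, so that the value of `Q` sits at the FIXED
  position `L` (`getD_gateValues_padBlock`); blocks with internal references relocate freely
  (`ArithCircuit.gateValues_append_shift` of `ConstantFreeCircuits.lean`);
* `complexity_mul_self_le` : squaring costs one gate, `L(p · p) ≤ L(p) + 1` (the sharing
  combinator `ArithCircuit.square`, unlike the compositional `complexity_mul_le`); hence
  `complexity_X_pow_le` : `L(X_v^d) ≤ 2T` for `d < 2^T` (repeated squaring, Jukna 2023,
  Claim 6.18) and `complexity_monomial_le` : `L(x^δ) ≤ |σ| (2T + 1)` when all entries of `δ`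
  are `< 2^T`;
* `monBlock k T δ` : a gate list of the FIXED length `mSize σ T = |σ|(2T+1) + 1` whose last value is
  `x^δ` whenever the entries of `δ` are `< 2^T` (`getD_gateValues_monBlock`);
* the BLOCK LAYOUT of the contraction (Jukna 2023, Claim 6.17): old gate `i` becomes the block
  `block T base δ₀ δ₁ g` of the fixed length `kSize σ T = 2 mSize σ T + 3` at `base = kSize · i` —
  two monomial blocks for the correction monomials `x^{δ₀}`, `x^{δ₁}`, two product gates
  multiplying them onto the re-indexed operands (`ref`: old `gate j ↦ gate (kSize j + kPred)`,
  `var v ↦ const 1`), and `lastGate` (re-adding resp. multiplying); `length_block`,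
  `fanIn_of_mem_block`.  The semantics of the layout is part C.

Everything is over an arbitrary commutative semiring `k`.  Helper namespace `JssContraction`.
-/

noncomputable section

-- `Summit.ValiantsHypothesis.ValiantsHypothesis.…` is the tree's mandated single-conjunct layout
-- (Sub = Summit), so the duplicated namespace component is intended.
set_option linter.dupNamespace false

namespace Summit.ValiantsHypothesis.ValiantsHypothesis.Theorems.DivisionGapPerDivisionHard

open MvPolynomial Literature.Computability.AlgebraicComplexity ArithCircuit
open scoped NNReal

namespace JssContraction

variable {k : Type*} [CommSemiring k] {σ : Type*}

/-! ### Padding a circuit to a fixed length with its value at a fixed position -/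

/-- Appending `r` empty sum gates appends `r` zero values. [folklore] -/
theorem gateValues_append_replicate_sum_nil (G : List (Gate k σ)) (r : ℕ) :
    gateValues (G ++ List.replicate r (Gate.sum ([] : List (k × Operand k σ)))) =
      gateValues G ++ List.replicate r 0 := by
  induction r with
  | zero => simp
  | succ r ih =>
    rw [List.replicate_succ', ← List.append_assoc, gateValues_append_singleton, ih,
      List.replicate_succ', List.append_assoc]
    simp [Gate.eval]

/-- `padBlock L Q`: the (first `L`) gates of `Q`, then empty sum gates up to length `L`, then one
copy gate `1 • Q.output` (junk-truncated); `L + 1` gates in all.  For `Q.size ≤ L` the value at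
position `L` is `Q.eval`. [folklore] -/
def padBlock (L : ℕ) (Q : ArithCircuit k σ) : List (Gate k σ) :=
  Q.gates.take L ++ List.replicate (L - Q.size) (Gate.sum []) ++
    [Gate.sum [(1, Q.output.truncate Q.size)]]

/-- `padBlock L Q` has exactly `L + 1` gates. [folklore] -/
theorem length_padBlock (L : ℕ) (Q : ArithCircuit k σ) : (padBlock L Q).length = L + 1 := by
  simp only [padBlock, List.length_append, List.length_take, List.length_replicate,
    List.length_singleton, size]
  omega

/-- Padding keeps fan-in two. [folklore] -/
theorem fanIn_of_mem_padBlock {L : ℕ} {Q : ArithCircuit k σ} (hQ : Q.IsFanInTwo) {g : Gate k σ}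
    (hg : g ∈ padBlock L Q) : g.fanIn ≤ 2 := by
  simp only [padBlock, List.mem_append, List.mem_singleton] at hg
  rcases hg with (hg | hg) | rfl
  · exact hQ g (List.mem_of_mem_take hg)
  · rw [List.eq_of_mem_replicate hg]
    simp [Gate.fanIn, Gate.args]
  · simp [Gate.fanIn, Gate.args]

/-- The values of `padBlock L Q` for `Q.size ≤ L`: those of `Q`, then zeros, then `Q.eval`.
[folklore] -/
theorem gateValues_padBlock {L : ℕ} {Q : ArithCircuit k σ} (hQ : Q.size ≤ L) :
    gateValues (padBlock L Q) =
      gateValues Q.gates ++ List.replicate (L - Q.size) 0 ++ [Q.eval] := by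
  have htake : Q.gates.take L = Q.gates := List.take_of_length_le hQ
  rw [padBlock, htake, gateValues_append_singleton, gateValues_append_replicate_sum_nil]
  congr 1
  have hlen : (gateValues Q.gates).length = Q.size := gateValues_length Q.gates
  have h := Operand.eval_truncate_append (gateValues Q.gates) (List.replicate (L - Q.size) 0)
    Q.output
  rw [hlen] at h
  simp only [Gate.eval, List.map_cons, List.map_nil, List.sum_cons, List.sum_nil, add_zero,
    one_smul, h]
  rfl

/-- **The padded block carries `Q.eval` at the fixed position `L`.** [folklore] -/
theorem getD_gateValues_padBlock {L : ℕ} {Q : ArithCircuit k σ} (hQ : Q.size ≤ L) :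
    (gateValues (padBlock L Q)).getD L 0 = Q.eval := by
  rw [gateValues_padBlock hQ]
  have hlen : (gateValues Q.gates ++ List.replicate (L - Q.size) (0 : MvPolynomial σ k)).length
      = L := by
    rw [List.length_append, gateValues_length, List.length_replicate, size]
    simp only [size] at hQ
    omega
  rw [List.getD_append_right _ _ _ _ hlen.le, hlen, Nat.sub_self]
  rfl

/-! ### Repeated squaring: cheap bounded monomials (Jukna 2023, Claim 6.18) -/

/-- **Squaring costs one gate**: `L(p · p) ≤ L(p) + 1` (one product gate reading the output twice;
the compositional `complexity_mul_le` would lose the sharing). [folklore] -/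
theorem complexity_mul_self_le (p : MvPolynomial σ k) : complexity (p * p) ≤ complexity p + 1 := by
  obtain ⟨P, h2, hP, hs⟩ := exists_computes_size_eq_complexity p
  rw [← hs, ← size_square P]
  refine complexity_le_size h2.square ?_
  show P.square.eval = p * p
  rw [square_eval, sq, show P.eval = p from hP]

/-- **Powers of a variable by repeated squaring**: `L(X_v^d) ≤ 2T` whenever `d < 2^T`
(Jukna 2023, Claim 6.18). [folklore] -/
theorem complexity_X_pow_le (v : σ) (T : ℕ) :
    ∀ d : ℕ, d < 2 ^ T → complexity (X v ^ d : MvPolynomial σ k) ≤ 2 * T := by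
  induction T with
  | zero =>
    intro d hd
    have hd0 : d = 0 := by omega
    rw [hd0, pow_zero, ← C_1, complexity_C_holds]
  | succ T ih =>
    intro d hd
    have hhalf : d / 2 < 2 ^ T := by rw [pow_succ] at hd; omega
    have hsplit : (X v ^ d : MvPolynomial σ k) = X v ^ (d / 2) * X v ^ (d / 2) * X v ^ (d % 2) := by
      rw [← pow_add, ← pow_add]
      congr 1
      omega
    have hbit : complexity (X v ^ (d % 2) : MvPolynomial σ k) = 0 := by
      rcases Nat.mod_two_eq_zero_or_one d with h | h
      · rw [h, pow_zero, ← C_1, complexity_C_holds]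
      · rw [h, pow_one, complexity_X_holds]
    rw [hsplit]
    calc complexity (X v ^ (d / 2) * X v ^ (d / 2) * X v ^ (d % 2) : MvPolynomial σ k)
        ≤ complexity (X v ^ (d / 2) * X v ^ (d / 2) : MvPolynomial σ k) +
            complexity (X v ^ (d % 2) : MvPolynomial σ k) + 1 := complexity_mul_le_holds _ _
      _ ≤ (complexity (X v ^ (d / 2) : MvPolynomial σ k) + 1) + 0 + 1 := by
          rw [hbit]
          exact Nat.add_le_add_right (Nat.add_le_add_right (complexity_mul_self_le _) 0) 1
      _ ≤ 2 * T + 1 + 0 + 1 := by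
          have := ih (d / 2) hhalf
          omega
      _ = 2 * (T + 1) := by ring

/-- **Bounded monomials are cheap**: if every entry of `δ` is `< 2^T` then
`L(x^δ) ≤ |σ| · (2T + 1)` (one repeated-squaring chain per variable and the products;
Jukna 2023, Claim 6.18). [folklore] -/
theorem complexity_monomial_le [Fintype σ] (T : ℕ) (δ : σ →₀ ℕ) (hδ : ∀ v, δ v < 2 ^ T) :
    complexity (monomial δ (1 : k)) ≤ Fintype.card σ * (2 * T + 1) := by
  classical
  rw [← prod_X_pow_eq_monomial]
  calc complexity (∏ v ∈ δ.support, (X v : MvPolynomial σ k) ^ δ v)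
      ≤ ∑ v ∈ δ.support, complexity ((X v : MvPolynomial σ k) ^ δ v) + δ.support.card :=
        complexity_finset_prod_le _ _
    _ ≤ ∑ _v ∈ δ.support, 2 * T + δ.support.card := by
        gcongr with v _
        exact complexity_X_pow_le v T (δ v) (hδ v)
    _ = δ.support.card * (2 * T + 1) := by
        rw [Finset.sum_const, smul_eq_mul]; ring
    _ ≤ Fintype.card σ * (2 * T + 1) :=
        Nat.mul_le_mul_right _ (Finset.card_le_univ _)

/-! ### The fixed-shape monomial block -/

section MonBlock

variable (σ) in
/-- `mPred σ T = |σ| (2T + 1)`: the size budget of a bounded-monomial circuit; the monomial block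
has `mSize σ T = mPred σ T + 1` gates and carries its value at position `mPred σ T`. [folklore] -/
def mPred [Fintype σ] (T : ℕ) : ℕ := Fintype.card σ * (2 * T + 1)

variable (σ) in
/-- `mSize σ T = mPred σ T + 1`, the length of every monomial block. [folklore] -/
def mSize [Fintype σ] (T : ℕ) : ℕ := mPred σ T + 1

variable (k) in
/-- `monBlock k T δ`: a size-minimal fan-in-two circuit for `x^δ`, padded to the fixed length
`mSize σ T` with its value copied to the last position `mPred σ T` (meaningful when all entries
of `δ` are `< 2^T`, by `complexity_monomial_le`). [folklore] -/
def monBlock [Fintype σ] (T : ℕ) (δ : σ →₀ ℕ) : List (Gate k σ) :=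
  padBlock (mPred σ T)
    (Classical.choose (exists_computes_size_eq_complexity (monomial δ (1 : k))))

variable [Fintype σ]

/-- The monomial block has the fixed length `mSize σ T`. [folklore] -/
@[simp] theorem length_monBlock (T : ℕ) (δ : σ →₀ ℕ) :
    (monBlock k T δ).length = mSize σ T :=
  length_padBlock _ _

/-- Every gate of a monomial block has fan-in at most two. [folklore] -/
theorem fanIn_of_mem_monBlock {T : ℕ} {δ : σ →₀ ℕ} {g : Gate k σ} (hg : g ∈ monBlock k T δ) :
    g.fanIn ≤ 2 :=
  fanIn_of_mem_padBlock
    (Classical.choose_spec (exists_computes_size_eq_complexity (monomial δ (1 : k)))).1 hg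

/-- **The monomial block computes `x^δ` at position `mPred σ T`** when all entries of `δ` are
`< 2^T`. [folklore] -/
theorem getD_gateValues_monBlock {T : ℕ} {δ : σ →₀ ℕ} (hδ : ∀ v, δ v < 2 ^ T) :
    (gateValues (monBlock k T δ)).getD (mPred σ T) 0 = monomial δ (1 : k) := by
  obtain ⟨h2, hc, hs⟩ :=
    Classical.choose_spec (exists_computes_size_eq_complexity (monomial δ (1 : k)))
  have hle : (Classical.choose (exists_computes_size_eq_complexity (monomial δ (1 : k)))).size ≤
      mPred σ T := by
    rw [hs]
    exact complexity_monomial_le T δ hδ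
  rw [monBlock, getD_gateValues_padBlock hle]
  exact hc

end MonBlock

/-! ### The block layout of the contraction -/

section Layout

variable [Fintype σ]

variable (σ) in
/-- `kPred σ T = 2 · mSize σ T + 2`: the offset, inside its block, of the gate carrying the
contracted value of an old gate. [folklore] -/
def kPred (T : ℕ) : ℕ := 2 * mSize σ T + 2

variable (σ) in
/-- `kSize σ T = kPred σ T + 1`: the length of the block replacing one old gate. [folklore] -/
def kSize (T : ℕ) : ℕ := kPred σ T + 1

/-- Block positions compare like old indices: `(K'+1) j + K' < (K'+1) i ↔ j < i`. [folklore] -/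
theorem block_index_lt_iff (K' i j : ℕ) : (K' + 1) * j + K' < (K' + 1) * i ↔ j < i := by
  constructor
  · intro h
    exact Nat.lt_of_mul_lt_mul_left (lt_of_le_of_lt (Nat.le_add_right _ _) h)
  · intro h
    have h1 : (K' + 1) * (j + 1) ≤ (K' + 1) * i := Nat.mul_le_mul_left (K' + 1) h
    have h2 : (K' + 1) * (j + 1) = (K' + 1) * j + K' + 1 := by ring
    omega

/-- Re-indexing of operands: the contracted value of old gate `j` sits at new position
`kSize · j + kPred`; a variable contracts to the constant `1`, a constant to itself. [folklore] -/
def ref (T : ℕ) : Operand k σ → Operand k σ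
  | .var _ => .const 1
  | .const c => .const c
  | .gate j => .gate (kSize σ T * j + kPred σ T)

omit [Fintype σ] in
/-- Operand number `i` of a gate (`const 0` if absent). [folklore] -/
def opd (g : Gate k σ) (i : ℕ) : Operand k σ :=
  g.args.getD i (.const 0)

/-- The last gate of the block at `base` replacing the old gate `g`: it re-adds the two corrected
contracted operands (positions `base + 2 mSize`, `base + 2 mSize + 1`) for a binary sum, and
directly combines the re-indexed operands otherwise (fan-in `≥ 3` is junk). [folklore] -/
def lastGate (T base : ℕ) : Gate k σ → Gate k σ
  | .sum [] => .sum []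
  | .sum [(c, u)] => .sum [(c, ref T u)]
  | .sum [(c, _), (d, _)] =>
      .sum [(c, .gate (base + 2 * mSize σ T)), (d, .gate (base + 2 * mSize σ T + 1))]
  | .sum (_ :: _ :: _ :: _) => .sum []
  | .prod [] => .prod []
  | .prod [u] => .prod [ref T u]
  | .prod [u, u'] => .prod [ref T u, ref T u']
  | .prod (_ :: _ :: _ :: _) => .prod []

/-- The block (of length `kSize σ T`) at position `base` replacing the old gate `g`, given the two
correction exponents `δ₀`, `δ₁`: two monomial blocks for `x^{δ₀}`, `x^{δ₁}`, two product gates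
`x^{δⱼ} · ref (operand j)`, and `lastGate`. [folklore] -/
def block (T base : ℕ) (δ₀ δ₁ : σ →₀ ℕ) (g : Gate k σ) : List (Gate k σ) :=
  (monBlock k T δ₀).map (Gate.shift base) ++
    (monBlock k T δ₁).map (Gate.shift (base + mSize σ T)) ++
    [Gate.prod [.gate (base + mPred σ T), ref T (opd g 0)],
      Gate.prod [.gate (base + mSize σ T + mPred σ T), ref T (opd g 1)],
      lastGate T base g]

/-- Each block has the fixed length `kSize σ T`. [folklore] -/
theorem length_block (T base : ℕ) (δ₀ δ₁ : σ →₀ ℕ) (g : Gate k σ) :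
    (block T base δ₀ δ₁ g).length = kSize σ T := by
  simp only [block, List.length_append, List.length_map, length_monBlock, List.length_cons,
    List.length_nil, kSize, kPred]
  ring

/-- The last gate of a block has fan-in at most two. [folklore] -/
theorem fanIn_lastGate (T base : ℕ) (g : Gate k σ) : (lastGate T base g).fanIn ≤ 2 := by
  cases g with
  | sum args =>
    rcases args with _ | ⟨⟨c, u⟩, _ | ⟨⟨d, v⟩, _ | ⟨e, rest⟩⟩⟩ <;>
      simp [lastGate, Gate.fanIn, Gate.args]
  | prod args =>
    rcases args with _ | ⟨u, _ | ⟨u', _ | ⟨u'', rest⟩⟩⟩ <;>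
      simp [lastGate, Gate.fanIn, Gate.args]

/-- Every gate of a block has fan-in at most two. [folklore] -/
theorem fanIn_of_mem_block {T base : ℕ} {δ₀ δ₁ : σ →₀ ℕ} {g g' : Gate k σ}
    (hg' : g' ∈ block T base δ₀ δ₁ g) : g'.fanIn ≤ 2 := by
  simp only [block, List.append_assoc, List.mem_append, List.mem_map, List.mem_cons,
    List.not_mem_nil, or_false] at hg'
  have hshift : ∀ (n : ℕ) (g₀ : Gate k σ), (g₀.shift n).fanIn = g₀.fanIn := fun n g₀ => by
    cases g₀ <;> simp [Gate.shift, Gate.fanIn, Gate.args]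
  rcases hg' with ⟨g₀, h₀, rfl⟩ | ⟨g₀, h₀, rfl⟩ | rfl | rfl | rfl
  · rw [hshift]; exact fanIn_of_mem_monBlock h₀
  · rw [hshift]; exact fanIn_of_mem_monBlock h₀
  · simp [Gate.fanIn, Gate.args]
  · simp [Gate.fanIn, Gate.args]
  · exact fanIn_lastGate T base g

end Layout

end JssContraction

/-- **Registered sub-goal `stub_jssContraction_partB` of stub `stub_jssContraction`** (part B in
closed form): the fixed-shape monomial block is correct — for every exponent vector `δ` with
entries `< 2^T`, the gate list `monBlock ℝ≥0 T δ` (of length `|σ|(2T+1) + 1`) carries `x^δ` at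
position `|σ|(2T+1)` (repeated squaring, Jukna 2023, Claim 6.18) —
`JssContraction.getD_gateValues_monBlock`. [folklore] -/
theorem stub_jssContraction_partB :
    ∀ (σ : Type) [Fintype σ] (T : ℕ) (δ : σ →₀ ℕ), (∀ v, δ v < 2 ^ T) →
      (gateValues (JssContraction.monBlock ℝ≥0 T δ)).getD (JssContraction.mPred σ T) 0 =
        monomial δ (1 : ℝ≥0) :=
  fun _ _ _ _ hδ => JssContraction.getD_gateValues_monBlock hδ

end Summit.ValiantsHypothesis.ValiantsHypothesis.Theorems.DivisionGapPerDivisionHard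

end
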